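import Literature.Computability.AlgebraicComplexity.GraphTensorCycleSurgery
import Mathlib.Data.Finset.Sort
import Mathlib.Algebra.BigOperators.Ring.Finset
import Mathlib.Algebra.BigOperators.GroupWithZero.Finset
import Mathlib.Analysis.SpecialFunctions.Pow.Real
import Mathlib.Analysis.SpecificLimits.Basic
import HarnessLib

/-!
# Clique covers: `R(T_{n^{k-2}}(K_k)) ≤ R(T_n(K_{k-1}))^k`, `τ(T(K_k)) ≤ τ(T(K_ℓ))` for `k ≥ ℓ ≥ 2`
# (Christandl–Vrana–Zuiddam 2019, Prop. 1.1.26) — discharge of `cvz19_prop_1_1_26`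

Topic `Literature/Computability/AlgebraicComplexity`, sequel of `GraphTensor.lean` (`graphTensor`, `cliqueSlots`,
`graphExponents`, `graphOmega`, `graphTau`, the named fact `cvz19_prop_1_1_26`) and `GraphTensorCycleSurgery.lean`
(`reindex`, `tensorRankD_reindex_le`).  Everything here is PROVED; no definition of a `Prop`, no new named fact.

## What is printed

[CVZ19] M. Christandl, P. Vrana, J. Zuiddam, *Asymptotic tensor rank of graph tensors: beyond matrix
multiplication*, comput. complexity 28 (2019) = arXiv:1609.07476, Prop. 1.1.26 (held text p0007:L42–L60):
"Let `k ≥ ℓ ≥ 2` be integers. Then `τ(T(K_k)) ≤ τ(T(K_ℓ))`.  *Proof.* Let `τ_ℓ = τ(T(K_ℓ))`. Label the vertices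
of `K_k` by `1,…,k`. Then, for any subgraph `G` in `K_k` isomorphic to `K_ℓ` we have, with subscripts denoting
tensor leg positions, `((T(G))_{V(G)} ⊗ (1 ⊗ ⋯ ⊗ 1)_{[k]∖V(G)})^{⊗N} ≤ T^{⊗(binom(ℓ,2) τ_ℓ N + o(N))}` and so
`⊗_{G ⊆ K_k, G ≅ K_ℓ} ((T(G))_{V(G)} ⊗ (1 ⊗ ⋯ ⊗ 1)_{[k]∖V(G)})^{⊗N} ≤ T^{⊗(binom(ℓ,2) τ_ℓ N + o(N)) binom(k,ℓ)}`,
the tensor product taken over all subgraphs `G` in `K_k` isomorphic to `K_ℓ`.  The left-hand side is isomorphic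
to `T(K_k)^{⊗ N binom(k-2, ℓ-2)}`.  Therefore, we have the upper bound
`ω(T(K_k)) ≤ binom(ℓ,2) binom(k,ℓ) binom(k-2,ℓ-2)^{-1} τ_ℓ = binom(k,2) τ_ℓ`, so `τ(T(K_k)) ≤ τ_ℓ`."

## How it is rendered (the printed covering argument, in the rank currency of the tree's `graphOmega`)

The tree's `ω(T(G))` is `inf {β | R(T_n(G)) = O(n^β)}` (CVZ19 Prop. 1.1.18, `GraphTensor.graphOmega`), so the
covering argument is run on the ranks `R(T_n(G))` rather than on Kronecker powers, and for the cover of `K_k` by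
its `k` subcliques `K_k − a ≅ K_{k-1}` (`ℓ = k − 1`; every edge lies in `k − 2` of them) followed by induction on
`k` — the same argument as printed, with the shortest bookkeeping.  With `k = d + 2`:

* §0 `tensorRankD_graphTensor_mono`: `R(T_N(G)) ≤ R(T_{N'}(G))` for `N ≤ N'` (`T_N(G)` is the re-indexing of
  `T_{N'}(G)` along the level embedding `[N] ⊆ [N']`).
* §1 the combinatorics of the cover: `coPos` (the inverse of `Fin.succAbove`), the increasing enumeration
  `offVertex e : Fin d → Fin (d+2)` of the `d` vertices off an edge `e` of `K_{d+2}` and its inverse `offIndex`,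
  and `subLegIndex a u x`: the leg index of the vertex `u` of the copy `K_{d+2} − a` (embedded by `a.succAbove`)
  read off from the leg index `x ∈ [(n^d)^{d+1}]` of the vertex `a.succAbove u` of `T_{n^d}(K_{d+2})` — the label
  of the edge `{v, w}` of `K_{d+2}` at level `n^d = |[n]^{d}|` is a `d`-tuple of level-`n` labels, one for each
  of the `d` copies `K_{d+2} − a`, `a ∉ {v, w}`, containing it ("the left-hand side is isomorphic to
  `T(K_k)^{⊗N binom(k-2,ℓ-2)}`").
* §2 the cover map `cliqueCover S = (i ↦ ∏_a S_a (u ↦ subLegIndex a u (i (a.succAbove u))))` on `(d+2)`-tuples of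
  `(d+1)`-leg tensors ("`⊗_G (T(G))_{V(G)} ⊗ (1 ⊗ ⋯ ⊗ 1)`" in coordinates): it is multilinear (`cliqueCover_sum`),
  takes rank-one tuples to ONE rank-one tensor (`cliqueCover_rankOneTensor`), and takes
  `(T_n(K_{d+1}), …, T_n(K_{d+1}))` to `T_{n^d}(K_{d+2})` (`cliqueCover_graphTensor`).
* §3 **`tensorRankD_cliqueSlots_succ_le : R(T_{n^d}(K_{d+2})) ≤ R(T_n(K_{d+1}))^{d+2}`**.
* §4 exponents: `mem_graphExponents_cliqueSlots_succ` (`β` admissible for `K_{d+1}` ⇒ `(d+2)/d · β` admissible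
  for `K_{d+2}`, through `n(N) = ⌈N^{1/d}⌉`), `graphOmega_cliqueSlots_succ_le`
  (`ω(T(K_{d+2})) ≤ (d+2)/d · ω(T(K_{d+1}))`, i.e. the printed `ω(T(K_k)) ≤ binom(k,2) τ_{k-1}`),
  `graphTau_cliqueSlots_succ_le` (`τ(T(K_{d+2})) ≤ τ(T(K_{d+1}))`), `graphTau_cliqueSlots_antitone` and the
  discharge **`cvz19_prop_1_1_26_holds`** (every field for the inequalities; the fact is stated at `ℂ`).

No `sorry`, no axiom, no instance, no notation, no `Prop`-valued definition.

## References

* [CVZ19] Christandl–Vrana–Zuiddam, arXiv:1609.07476, Def. 1.1.1, Prop. 1.1.18, Def. 1.1.25, Prop. 1.1.26 (with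
  its proof, p. 7). [ChristandlVranaZuiddam2016]
-/

noncomputable section

open scoped BigOperators
open Filter Asymptotics

namespace Literature.Computability.AlgebraicComplexity

/-! ## §0 The rank of `T_N(G)` is monotone in the level `N` -/

section LevelMono

variable {F : Type*} [Field F] {k D : ℕ} {E : Type*} [Fintype E] [DecidableEq E]

/-- The level embedding `[N]^D ⊆ [N']^D` of leg indices (`N ≤ N'`), coordinatewise `Fin.castLE`.
[cite: ChristandlVranaZuiddam2016, Def. 1.1.1] -/
def levelMap (D : ℕ) {N N' : ℕ} (h : N ≤ N') (x : Fin (N ^ D)) : Fin (N' ^ D) :=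
  finFunctionFinEquiv fun j => Fin.castLE h (finFunctionFinEquiv.symm x j)

omit [Fintype E] [DecidableEq E] in
/-- `slotIndex σ l v = x` says: the label of the edge in slot `j` of `v` is the `j`-th coordinate of `x`.
[cite: ChristandlVranaZuiddam2016, Def. 1.1.1] -/
theorem slotIndex_eq_iff (σ : Fin k → Fin D → E) {n : ℕ} (l : E → Fin n) (v : Fin k) (x : Fin (n ^ D)) :
    slotIndex σ l v = x ↔ ∀ j, l (σ v j) = finFunctionFinEquiv.symm x j := by
  rw [slotIndex, Equiv.apply_eq_iff_eq_symm_apply, funext_iff]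

/-- **`T_N(G)` is the re-indexing of `T_{N'}(G)` along the level embedding** (`N ≤ N'`, no empty edge): a
labelling with labels in `[N]` is a labelling with labels in `[N']` all of whose labels are `< N`.
[cite: ChristandlVranaZuiddam2016, Def. 1.1.1] -/
theorem graphTensor_eq_reindex_levelMap (σ : Fin k → Fin D → E) (hσ : ∀ e, ∃ v j, σ v j = e) {N N' : ℕ}
    (h : N ≤ N') : graphTensor F σ N = reindex (fun _ => levelMap D h) (graphTensor F σ N') := by
  classical
  funext i
  rw [reindex_apply, graphTensor_apply_of_covering hσ, graphTensor_apply_of_covering hσ]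
  refine if_congr ⟨?_, ?_⟩ rfl rfl
  · rintro ⟨l, rfl⟩
    refine ⟨fun e => Fin.castLE h (l e), funext fun v => ?_⟩
    simp [slotIndex, levelMap]
  · rintro ⟨l', hl'⟩
    have key : ∀ v j, l' (σ v j) = Fin.castLE h (finFunctionFinEquiv.symm (i v) j) := fun v j => by
      have hv := (slotIndex_eq_iff σ l' v _).1 (congrFun hl' v) j
      simpa [levelMap] using hv
    have hlt : ∀ e, (l' e : ℕ) < N := fun e => by
      obtain ⟨v, j, rfl⟩ := hσ e
      rw [key v j, Fin.val_castLE]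
      exact Fin.isLt _
    refine ⟨fun e => ⟨l' e, hlt e⟩, funext fun v => (slotIndex_eq_iff σ _ v _).2 fun j => Fin.ext ?_⟩
    change (l' (σ v j) : ℕ) = _
    rw [key v j, Fin.val_castLE]

/-- **The rank of `T_N(G)` is monotone in the level `N`** (no empty edge). [cite: ChristandlVranaZuiddam2016, Def. 1.1.1] -/
theorem tensorRankD_graphTensor_mono [NeZero k] (σ : Fin k → Fin D → E) (hσ : ∀ e, ∃ v j, σ v j = e)
    {N N' : ℕ} (h : N ≤ N') : tensorRankD (graphTensor F σ N) ≤ tensorRankD (graphTensor F σ N') := by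
  rw [graphTensor_eq_reindex_levelMap σ hσ h]
  exact tensorRankD_reindex_le _ _

end LevelMono

/-! ## §1 The combinatorics of the cover of `K_{d+2}` by the `d + 2` subcliques `K_{d+2} − a` -/

section Combinatorics

/-- The position of `x ≠ a` in the increasing enumeration `a.succAbove` of `[m+1] ∖ {a}` (the vertex of the copy
`K − a` sitting at `x`). [cite: ChristandlVranaZuiddam2016, Prop. 1.1.26 (proof)] -/
def coPos {m : ℕ} (a x : Fin (m + 1)) (h : x ≠ a) : Fin m :=
  (finSuccAboveEquiv a).symm ⟨x, h⟩

/-- `a.succAbove (coPos a x) = x`. [cite: ChristandlVranaZuiddam2016, Prop. 1.1.26 (proof)] -/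
@[simp] theorem succAbove_coPos {m : ℕ} (a x : Fin (m + 1)) (h : x ≠ a) : a.succAbove (coPos a x h) = x := by
  have h' := congrArg Subtype.val ((finSuccAboveEquiv a).apply_symm_apply ⟨x, h⟩)
  rwa [finSuccAboveEquiv_apply] at h'

/-- `coPos a x` is characterised by `a.succAbove (coPos a x) = x`. [cite: ChristandlVranaZuiddam2016, Prop. 1.1.26 (proof)] -/
theorem coPos_eq_of_succAbove_eq {m : ℕ} {a x : Fin (m + 1)} {h : x ≠ a} {u : Fin m} (hu : a.succAbove u = x) :
    coPos a x h = u :=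
  Fin.succAbove_right_injective (p := a) (by rw [succAbove_coPos, hu])

/-- `coPos a (a.succAbove u) = u`. [cite: ChristandlVranaZuiddam2016, Prop. 1.1.26 (proof)] -/
@[simp] theorem coPos_succAbove {m : ℕ} (a : Fin (m + 1)) (u : Fin m) (h : a.succAbove u ≠ a) :
    coPos a (a.succAbove u) h = u :=
  coPos_eq_of_succAbove_eq rfl

variable {d : ℕ}

/-- The `d` vertices of `K_{d+2}` off the edge `e`. [cite: ChristandlVranaZuiddam2016, Prop. 1.1.26 (proof)] -/
def offEdge (e : CliqueEdge (d + 2)) : Finset (Fin (d + 2)) :=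
  Finset.univ.filter fun a => a ∉ e.1

/-- Membership in `offEdge e`. [cite: ChristandlVranaZuiddam2016, Prop. 1.1.26 (proof)] -/
theorem mem_offEdge {e : CliqueEdge (d + 2)} {a : Fin (d + 2)} : a ∈ offEdge e ↔ a ∉ e.1 := by
  simp [offEdge]

/-- An edge of `K_{d+2}` misses exactly `d` vertices ("every edge lies in `binom(k-2, ℓ-2)` of the subgraphs").
[cite: ChristandlVranaZuiddam2016, Prop. 1.1.26 (proof)] -/
theorem card_offEdge (e : CliqueEdge (d + 2)) : (offEdge e).card = d := by
  obtain ⟨e, he⟩ := e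
  induction e using Sym2.ind with
  | h v w =>
    have hvw : v ≠ w := fun h => he (by rw [Sym2.mk_isDiag_iff]; exact h)
    have hset : offEdge ⟨s(v, w), he⟩ = ({v, w} : Finset (Fin (d + 2)))ᶜ := by
      ext a
      simp [offEdge, Sym2.mem_iff, not_or]
    rw [hset, Finset.card_compl, Fintype.card_fin, Finset.card_pair hvw]
    rfl

/-- The increasing bijection `Fin d ≃o offEdge e`. [cite: ChristandlVranaZuiddam2016, Prop. 1.1.26 (proof)] -/
def offIso (e : CliqueEdge (d + 2)) : Fin d ≃o offEdge e :=
  (offEdge e).orderIsoOfFin (card_offEdge e)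

/-- The `t`-th vertex off the edge `e` (increasing order): the `t`-th copy `K_{d+2} − a` containing `e`.
[cite: ChristandlVranaZuiddam2016, Prop. 1.1.26 (proof)] -/
def offVertex (e : CliqueEdge (d + 2)) (t : Fin d) : Fin (d + 2) :=
  (offIso e t).1

/-- `offVertex e t ∉ e`. [cite: ChristandlVranaZuiddam2016, Prop. 1.1.26 (proof)] -/
theorem offVertex_not_mem (e : CliqueEdge (d + 2)) (t : Fin d) : offVertex e t ∉ e.1 :=
  mem_offEdge.1 (offIso e t).2

/-- The index of a vertex `a ∉ e` among the vertices off `e`. [cite: ChristandlVranaZuiddam2016, Prop. 1.1.26 (proof)] -/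
def offIndex (e : CliqueEdge (d + 2)) (a : Fin (d + 2)) (h : a ∉ e.1) : Fin d :=
  (offIso e).symm ⟨a, mem_offEdge.2 h⟩

/-- `offVertex e (offIndex e a) = a`. [cite: ChristandlVranaZuiddam2016, Prop. 1.1.26 (proof)] -/
@[simp] theorem offVertex_offIndex (e : CliqueEdge (d + 2)) (a : Fin (d + 2)) (h : a ∉ e.1) :
    offVertex e (offIndex e a h) = a := by
  simp [offVertex, offIndex]

/-- `offIndex e (offVertex e t) = t`. [cite: ChristandlVranaZuiddam2016, Prop. 1.1.26 (proof)] -/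
@[simp] theorem offIndex_offVertex (e : CliqueEdge (d + 2)) (t : Fin d) (h : offVertex e t ∉ e.1) :
    offIndex e (offVertex e t) h = t := by
  simp [offVertex, offIndex]

/-- `offIndex` only depends on the edge (proof-irrelevant congruence). [cite: ChristandlVranaZuiddam2016, Prop. 1.1.26 (proof)] -/
theorem offIndex_congr {e e' : CliqueEdge (d + 2)} (hee' : e = e') {a : Fin (d + 2)} (h : a ∉ e.1)
    (h' : a ∉ e'.1) : offIndex e a h = offIndex e' a h' := by
  subst hee'
  rfl

/-- In the copy `K_{d+2} − a` (vertex `u` sits at `a.succAbove u`), the slot `j` of `u` reads the edge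
`{u, u.succAbove j}`, i.e. the edge `{a.succAbove u, a.succAbove (u.succAbove j)}` of `K_{d+2}`; its far endpoint
differs from `a.succAbove u`. [cite: ChristandlVranaZuiddam2016, Prop. 1.1.26 (proof)] -/
theorem succAbove_succAbove_ne (a : Fin (d + 2)) (u : Fin (d + 1)) (j : Fin d) :
    a.succAbove (u.succAbove j) ≠ a.succAbove u :=
  fun h => Fin.succAbove_ne u j (Fin.succAbove_right_injective h)

/-- The slot of `a.succAbove u` in `K_{d+2}` reading that edge. [cite: ChristandlVranaZuiddam2016, Prop. 1.1.26 (proof)] -/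
def bigSlot (a : Fin (d + 2)) (u : Fin (d + 1)) (j : Fin d) : Fin (d + 1) :=
  coPos (a.succAbove u) (a.succAbove (u.succAbove j)) (succAbove_succAbove_ne a u j)

/-- `(a.succAbove u).succAbove (bigSlot a u j) = a.succAbove (u.succAbove j)`. [cite: ChristandlVranaZuiddam2016, Prop. 1.1.26 (proof)] -/
@[simp] theorem succAbove_bigSlot (a : Fin (d + 2)) (u : Fin (d + 1)) (j : Fin d) :
    (a.succAbove u).succAbove (bigSlot a u j) = a.succAbove (u.succAbove j) :=
  succAbove_coPos _ _ _

/-- That edge, as an edge of `K_{d+2}` in the presentation `cliqueSlots (d+1)`. [cite: ChristandlVranaZuiddam2016, Prop. 1.1.26 (proof)] -/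
def bigEdge (a : Fin (d + 2)) (u : Fin (d + 1)) (j : Fin d) : CliqueEdge (d + 2) :=
  cliqueSlots (d + 1) (a.succAbove u) (bigSlot a u j)

/-- `bigEdge a u j = {a.succAbove u, a.succAbove (u.succAbove j)}`. [cite: ChristandlVranaZuiddam2016, Prop. 1.1.26 (proof)] -/
theorem bigEdge_val (a : Fin (d + 2)) (u : Fin (d + 1)) (j : Fin d) :
    (bigEdge a u j).1 = s(a.succAbove u, a.succAbove (u.succAbove j)) := by
  simp [bigEdge, cliqueSlots]

/-- The deleted vertex `a` is off every edge of its copy. [cite: ChristandlVranaZuiddam2016, Prop. 1.1.26 (proof)] -/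
theorem not_mem_bigEdge (a : Fin (d + 2)) (u : Fin (d + 1)) (j : Fin d) : a ∉ (bigEdge a u j).1 := by
  rw [bigEdge_val, Sym2.mem_iff, not_or]
  exact ⟨(Fin.succAbove_ne a u).symm, (Fin.succAbove_ne a _).symm⟩

/-- The coordinate of the level-`n^d` label of that edge belonging to the copy `K_{d+2} − a`.
[cite: ChristandlVranaZuiddam2016, Prop. 1.1.26 (proof)] -/
def fibreIndex (a : Fin (d + 2)) (u : Fin (d + 1)) (j : Fin d) : Fin d :=
  offIndex (bigEdge a u j) a (not_mem_bigEdge a u j)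

variable {n : ℕ}

/-- **The leg index of the vertex `u` of the copy `K_{d+2} − a` in `T_n(K_{d+1})`, read off from the leg index
`x ∈ [(n^d)^{d+1}]` of the vertex `a.succAbove u` of `T_{n^d}(K_{d+2})`**: slot `j` carries the `a`-coordinate of
the (`d`-tuple) label of the edge `{a.succAbove u, a.succAbove (u.succAbove j)}`.
[cite: ChristandlVranaZuiddam2016, Prop. 1.1.26 (proof)] -/
def subLegIndex (a : Fin (d + 2)) (u : Fin (d + 1)) (x : Fin ((n ^ d) ^ (d + 1))) : Fin (n ^ d) :=
  finFunctionFinEquiv fun j =>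
    finFunctionFinEquiv.symm (finFunctionFinEquiv.symm x (bigSlot a u j)) (fibreIndex a u j)

/-- Coordinates of `subLegIndex`. [cite: ChristandlVranaZuiddam2016, Prop. 1.1.26 (proof)] -/
@[simp] theorem subLegIndex_coord (a : Fin (d + 2)) (u : Fin (d + 1)) (x : Fin ((n ^ d) ^ (d + 1))) (j : Fin d) :
    finFunctionFinEquiv.symm (subLegIndex a u x) j =
      finFunctionFinEquiv.symm (finFunctionFinEquiv.symm x (bigSlot a u j)) (fibreIndex a u j) := by
  simp [subLegIndex]

/-- The pairs `(a, u)` (copy, vertex of the copy) and `(v, t)` (vertex of `K_{d+2}`, index of a copy through it)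
correspond by `v = a.succAbove u`, `a = v.succAbove t`; this correspondence is an involution of
`Fin (d+2) × Fin (d+1)`. [cite: ChristandlVranaZuiddam2016, Prop. 1.1.26 (proof)] -/
def pairSwap (p : Fin (d + 2) × Fin (d + 1)) : Fin (d + 2) × Fin (d + 1) :=
  (p.1.succAbove p.2, coPos (p.1.succAbove p.2) p.1 (Fin.succAbove_ne p.1 p.2).symm)

/-- `pairSwap` is an involution. [cite: ChristandlVranaZuiddam2016, Prop. 1.1.26 (proof)] -/
theorem pairSwap_pairSwap (p : Fin (d + 2) × Fin (d + 1)) : pairSwap (pairSwap p) = p := by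
  obtain ⟨a, u⟩ := p
  simp only [pairSwap]
  have h1 : (a.succAbove u).succAbove (coPos (a.succAbove u) a (Fin.succAbove_ne a u).symm) = a :=
    succAbove_coPos _ _ _
  refine Prod.ext h1 (coPos_eq_of_succAbove_eq ?_)
  rw [h1]

/-- `pairSwap` as a permutation. [cite: ChristandlVranaZuiddam2016, Prop. 1.1.26 (proof)] -/
def pairPerm : Equiv.Perm (Fin (d + 2) × Fin (d + 1)) :=
  Function.Involutive.toPerm pairSwap pairSwap_pairSwap

/-- **Regrouping a product over (copy, vertex of the copy) by the vertices of `K_{d+2}`.**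
[cite: ChristandlVranaZuiddam2016, Prop. 1.1.26 (proof)] -/
theorem prod_pairSwap {M : Type*} [CommMonoid M] (f : Fin (d + 2) → Fin (d + 1) → M) :
    ∏ v : Fin (d + 2), ∏ t : Fin (d + 1), f (v.succAbove t) (coPos (v.succAbove t) v (Fin.succAbove_ne v t).symm) =
      ∏ a, ∏ u, f a u := by
  rw [← Fintype.prod_prod_type', ← Fintype.prod_prod_type']
  exact Fintype.prod_equiv pairPerm _ _ fun p => rfl

end Combinatorics

/-! ## §2 The cover map -/

section Cover

variable {F : Type*} [Field F] {d n : ℕ}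

/-- **The cover map** ("`⊗_{G ≅ K_ℓ} (T(G))_{V(G)} ⊗ (1 ⊗ ⋯ ⊗ 1)_{[k]∖V(G)}`" in coordinates, `ℓ = k − 1`): a
`(d+2)`-tuple `S` of `(d+1)`-leg tensors at level `n` (one per copy `K_{d+2} − a`) gives the `(d+2)`-leg tensor at
level `n^d` whose entry at `i` is `∏_a S_a (u ↦ subLegIndex a u (i (a.succAbove u)))`.
[cite: ChristandlVranaZuiddam2016, Prop. 1.1.26 (proof)] -/
def cliqueCover (S : Fin (d + 2) → ((Fin (d + 1) → Fin (n ^ d)) → F)) :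
    (Fin (d + 2) → Fin ((n ^ d) ^ (d + 1))) → F :=
  fun i => ∏ a, S a fun u => subLegIndex a u (i (a.succAbove u))

/-- Unfolding lemma. [cite: ChristandlVranaZuiddam2016, Prop. 1.1.26 (proof)] -/
theorem cliqueCover_apply (S : Fin (d + 2) → ((Fin (d + 1) → Fin (n ^ d)) → F))
    (i : Fin (d + 2) → Fin ((n ^ d) ^ (d + 1))) :
    cliqueCover S i = ∏ a, S a fun u => subLegIndex a u (i (a.succAbove u)) := rfl

/-- **The cover map is multilinear**: a product of sums is the sum over choice functions of the products.
[cite: ChristandlVranaZuiddam2016, Prop. 1.1.26 (proof)] -/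
theorem cliqueCover_sum {R : ℕ} (X : Fin (d + 2) → Fin R → ((Fin (d + 1) → Fin (n ^ d)) → F)) :
    cliqueCover (fun a => ∑ r, X a r) = ∑ r : Fin (d + 2) → Fin R, cliqueCover fun a => X a (r a) := by
  classical
  funext i
  simp only [cliqueCover_apply, Finset.sum_apply]
  exact Fintype.prod_sum fun a r => X a r fun u => subLegIndex a u (i (a.succAbove u))

/-- The legs of the cover of a rank-one tuple `(⊗_u x_{a,u})_a`: the leg at the vertex `v` of `K_{d+2}` is the
product, over the `d + 1` copies `K_{d+2} − a` through `v` (`a = v.succAbove t`), of the legs `x_{a,u}` at the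
vertex `u` of the copy sitting at `v`, each read through `subLegIndex a u`.
[cite: ChristandlVranaZuiddam2016, Prop. 1.1.26 (proof)] -/
def cliqueCoverLeg (x : Fin (d + 2) → Fin (d + 1) → Fin (n ^ d) → F) :
    Fin (d + 2) → Fin ((n ^ d) ^ (d + 1)) → F :=
  fun v idx => ∏ t : Fin (d + 1),
    x (v.succAbove t) (coPos (v.succAbove t) v (Fin.succAbove_ne v t).symm)
      (subLegIndex (v.succAbove t) (coPos (v.succAbove t) v (Fin.succAbove_ne v t).symm) idx)

/-- **The cover map takes a tuple of rank-one tensors to ONE rank-one tensor.**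
[cite: ChristandlVranaZuiddam2016, Prop. 1.1.26 (proof)] -/
theorem cliqueCover_rankOneTensor (x : Fin (d + 2) → Fin (d + 1) → Fin (n ^ d) → F) :
    cliqueCover (fun a => rankOneTensor (x a)) = rankOneTensor (cliqueCoverLeg x) := by
  funext i
  simp only [cliqueCover_apply, rankOneTensor_apply, cliqueCoverLeg]
  have h := prod_pairSwap fun a u => x a u (subLegIndex a u (i (a.succAbove u)))
  simp only [succAbove_coPos] at h
  exact h.symm

/-- Transporting an edge of `K_{d+1}` into `K_{d+2}` along the copy `K_{d+2} − a`.
[cite: ChristandlVranaZuiddam2016, Prop. 1.1.26 (proof)] -/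
def pushEdge (a : Fin (d + 2)) (e : CliqueEdge (d + 1)) : CliqueEdge (d + 2) :=
  ⟨Sym2.map a.succAbove e.1, fun h => e.2 (by
    obtain ⟨e, he⟩ := e
    induction e using Sym2.ind with
    | h u u' =>
      rw [Sym2.map_mk, Sym2.mk_isDiag_iff] at h
      rw [Sym2.mk_isDiag_iff]
      exact Fin.succAbove_right_injective h)⟩

/-- `a ∉ pushEdge a e`. [cite: ChristandlVranaZuiddam2016, Prop. 1.1.26 (proof)] -/
theorem not_mem_pushEdge (a : Fin (d + 2)) (e : CliqueEdge (d + 1)) : a ∉ (pushEdge a e).1 := by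
  obtain ⟨e, he⟩ := e
  induction e using Sym2.ind with
  | h u u' =>
    simp only [pushEdge, Sym2.map_mk, Sym2.mem_iff, not_or]
    exact ⟨(Fin.succAbove_ne a u).symm, (Fin.succAbove_ne a u').symm⟩

/-- The slot edge `{u, u.succAbove j}` of the copy is transported to `bigEdge a u j`.
[cite: ChristandlVranaZuiddam2016, Prop. 1.1.26 (proof)] -/
theorem pushEdge_cliqueSlots (a : Fin (d + 2)) (u : Fin (d + 1)) (j : Fin d) :
    pushEdge a (cliqueSlots d u j) = bigEdge a u j := by
  apply Subtype.ext
  rw [bigEdge_val]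
  simp [pushEdge, cliqueSlots]

/-- The projection `Fin (d+2) → Fin (d+1)` inverting `a.succAbove` off `a` (junk value `0` at `a`).
[cite: ChristandlVranaZuiddam2016, Prop. 1.1.26 (proof)] -/
def coProj (a x : Fin (d + 2)) : Fin (d + 1) :=
  if h : x = a then 0 else coPos a x h

/-- `a.succAbove (coProj a x) = x` for `x ≠ a`. [cite: ChristandlVranaZuiddam2016, Prop. 1.1.26 (proof)] -/
theorem succAbove_coProj {a x : Fin (d + 2)} (h : x ≠ a) : a.succAbove (coProj a x) = x := by
  rw [coProj, dif_neg h, succAbove_coPos]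

/-- `coProj a (a.succAbove u) = u`. [cite: ChristandlVranaZuiddam2016, Prop. 1.1.26 (proof)] -/
@[simp] theorem coProj_succAbove (a : Fin (d + 2)) (u : Fin (d + 1)) : coProj a (a.succAbove u) = u := by
  rw [coProj, dif_neg (Fin.succAbove_ne a u), coPos_succAbove]

/-- Pulling an edge `e ∌ a` of `K_{d+2}` back to the copy `K_{d+2} − a`.
[cite: ChristandlVranaZuiddam2016, Prop. 1.1.26 (proof)] -/
def pullEdge (a : Fin (d + 2)) (e : CliqueEdge (d + 2)) (h : a ∉ e.1) : CliqueEdge (d + 1) :=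
  ⟨Sym2.map (coProj a) e.1, fun hd => e.2 (by
    obtain ⟨e, he⟩ := e
    induction e using Sym2.ind with
    | h v w =>
      rw [Sym2.mem_iff, not_or] at h
      rw [Sym2.map_mk, Sym2.mk_isDiag_iff] at hd
      rw [Sym2.mk_isDiag_iff, ← succAbove_coProj (Ne.symm h.1), hd, succAbove_coProj (Ne.symm h.2)])⟩

/-- `pushEdge a (pullEdge a e) = e` for `a ∉ e`. [cite: ChristandlVranaZuiddam2016, Prop. 1.1.26 (proof)] -/
theorem pushEdge_pullEdge (a : Fin (d + 2)) (e : CliqueEdge (d + 2)) (h : a ∉ e.1) :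
    pushEdge a (pullEdge a e h) = e := by
  apply Subtype.ext
  obtain ⟨e, he⟩ := e
  induction e using Sym2.ind with
  | h v w =>
    have h' := h
    rw [Sym2.mem_iff, not_or] at h'
    simp only [pushEdge, pullEdge, Sym2.map_mk]
    rw [succAbove_coProj (Ne.symm h'.1), succAbove_coProj (Ne.symm h'.2)]

/-- From labellings of the `d + 2` copies (with labels in `[n]`) whose slot tuples are the `subLegIndex`es of
`i` to a labelling of `K_{d+2}` with labels in `[n^d]` whose slot tuples are `i`: the `a`-coordinate of the label
of an edge `e ∌ a` is the label of `e` in the copy `K_{d+2} − a`. [cite: ChristandlVranaZuiddam2016, Prop. 1.1.26 (proof)] -/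
theorem exists_labelling_of_forall_copies (i : Fin (d + 2) → Fin ((n ^ d) ^ (d + 1)))
    (hl : ∀ a : Fin (d + 2), ∃ l : CliqueEdge (d + 1) → Fin n,
      slotIndex (cliqueSlots d) l = fun u => subLegIndex a u (i (a.succAbove u))) :
    ∃ L : CliqueEdge (d + 2) → Fin (n ^ d), slotIndex (cliqueSlots (d + 1)) L = i := by
  choose l hl using hl
  have hl' : ∀ a u j, l a (cliqueSlots d u j) =
      finFunctionFinEquiv.symm (finFunctionFinEquiv.symm (i (a.succAbove u)) (bigSlot a u j))
        (fibreIndex a u j) := fun a u j => by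
    have h := (slotIndex_eq_iff (cliqueSlots d) (l a) u _).1 (congrFun (hl a) u) j
    rwa [subLegIndex_coord] at h
  refine ⟨fun e => finFunctionFinEquiv fun t => l (offVertex e t) (pullEdge (offVertex e t) e
    (offVertex_not_mem e t)), funext fun v => (slotIndex_eq_iff _ _ v _).2 fun j' => ?_⟩
  apply finFunctionFinEquiv.symm.injective
  funext t
  simp only [Equiv.symm_apply_apply]
  -- the copy `a = offVertex e t` through the edge `e = {v, v.succAbove j'}`
  set e : CliqueEdge (d + 2) := cliqueSlots (d + 1) v j' with he
  set a : Fin (d + 2) := offVertex e t with ha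
  have hae : a ∉ e.1 := offVertex_not_mem e t
  have hav : v ≠ a := fun h => hae (by rw [he, ← h]; exact Sym2.mem_mk_left _ _)
  have haw : v.succAbove j' ≠ a := fun h => hae (by rw [he, ← h]; exact Sym2.mem_mk_right _ _)
  -- the vertices `u`, `u.succAbove j` of the copy sitting at `v`, `v.succAbove j'`
  set u : Fin (d + 1) := coProj a v with hu
  have huv : a.succAbove u = v := succAbove_coProj hav
  have hne : coProj a (v.succAbove j') ≠ u := fun h => by
    have h2 := congrArg a.succAbove h
    rw [succAbove_coProj haw, huv] at h2
    exact Fin.succAbove_ne v j' h2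
  set j : Fin d := coPos u (coProj a (v.succAbove j')) hne with hj
  have huj : a.succAbove (u.succAbove j) = v.succAbove j' := by
    rw [hj, succAbove_coPos, succAbove_coProj haw]
  have hpull : pullEdge a e hae = cliqueSlots d u j := by
    apply Subtype.ext
    simp only [pullEdge, he, cliqueSlots, Sym2.map_mk, hj, succAbove_coPos]
    rfl
  have hslot : bigSlot a u j = j' := coPos_eq_of_succAbove_eq (by rw [huv, huj])
  have hedge : bigEdge a u j = e := by
    rw [bigEdge, he, hslot, huv]
  have hfib : fibreIndex a u j = t := by
    rw [fibreIndex, offIndex_congr hedge (not_mem_bigEdge a u j) hae]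
    exact offIndex_offVertex e t _
  rw [hpull, hl' a u j, hslot, hfib, huv]

/-- From a labelling of `K_{d+2}` with labels in `[n^d]` whose slot tuples are `i` to a labelling of the copy
`K_{d+2} − a` with labels in `[n]` whose slot tuples are the `subLegIndex a`es of `i`: read the `a`-coordinates.
[cite: ChristandlVranaZuiddam2016, Prop. 1.1.26 (proof)] -/
theorem exists_copy_labelling_of_labelling {i : Fin (d + 2) → Fin ((n ^ d) ^ (d + 1))}
    {L : CliqueEdge (d + 2) → Fin (n ^ d)} (hL : slotIndex (cliqueSlots (d + 1)) L = i) (a : Fin (d + 2)) :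
    ∃ l : CliqueEdge (d + 1) → Fin n, slotIndex (cliqueSlots d) l = fun u => subLegIndex a u (i (a.succAbove u)) := by
  refine ⟨fun e => finFunctionFinEquiv.symm (L (pushEdge a e)) (offIndex (pushEdge a e) a (not_mem_pushEdge a e)),
    funext fun u => (slotIndex_eq_iff _ _ u _).2 fun j => ?_⟩
  rw [subLegIndex_coord, offIndex_congr (pushEdge_cliqueSlots a u j) (not_mem_pushEdge a _) (not_mem_bigEdge a u j),
    pushEdge_cliqueSlots, ← hL]
  have h := (slotIndex_eq_iff (cliqueSlots (d + 1)) L (a.succAbove u) _).1 rfl (bigSlot a u j)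
  rw [← h]
  rfl

/-- **The cover of `(T_n(K_{d+1}), …, T_n(K_{d+1}))` is `T_{n^d}(K_{d+2})`** ("the left-hand side is isomorphic
to `T(K_k)^{⊗N binom(k-2,ℓ-2)}`"): a labelling of `K_{d+2}` with labels in `[n]^d ≅ [n^d]` is the same thing as
a labelling with labels in `[n]` of each of the `d + 2` copies `K_{d+2} − a`, the `a`-coordinate of the label of
an edge `e ∌ a` being the label of `e` in the copy `K_{d+2} − a`. [cite: ChristandlVranaZuiddam2016, Prop. 1.1.26 (proof)] -/
theorem cliqueCover_graphTensor (d n : ℕ) :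
    cliqueCover (fun _ : Fin (d + 2) => graphTensor F (cliqueSlots d) n) =
      graphTensor F (cliqueSlots (d + 1)) (n ^ d) := by
  classical
  funext i
  rw [cliqueCover_apply, graphTensor_apply_of_covering (cliqueSlots_covering (d + 1))]
  simp_rw [graphTensor_apply_of_covering (cliqueSlots_covering d)]
  by_cases hL : ∃ L : CliqueEdge (d + 2) → Fin (n ^ d), slotIndex (cliqueSlots (d + 1)) L = i
  · rw [if_pos hL]
    obtain ⟨L, hL⟩ := hL
    exact Finset.prod_eq_one fun a _ => if_pos (exists_copy_labelling_of_labelling hL a)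
  · rw [if_neg hL]
    have h : ¬ ∀ a : Fin (d + 2), ∃ l : CliqueEdge (d + 1) → Fin n,
        slotIndex (cliqueSlots d) l = fun u => subLegIndex a u (i (a.succAbove u)) :=
      fun hl => hL (exists_labelling_of_forall_copies i hl)
    obtain ⟨a, ha⟩ := not_forall.1 h
    exact Finset.prod_eq_zero (Finset.mem_univ a) (if_neg ha)

end Cover

/-! ## §3 The rank bound `R(T_{n^d}(K_{d+2})) ≤ R(T_n(K_{d+1}))^{d+2}` -/

section RankBound

variable (F : Type*) [Field F]

/-- **`R(T_{n^d}(K_{d+2})) ≤ R(T_n(K_{d+1}))^{d+2}`** (CVZ19 Prop. 1.1.26, proof, `ℓ = k − 1`, in the rank currency):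
apply the cover map to an optimal decomposition of `T_n(K_{d+1})` in each of the `d + 2` copies; each choice of one
summand per copy gives one rank-one tensor. [cite: ChristandlVranaZuiddam2016, Prop. 1.1.26 (proof)] -/
theorem tensorRankD_cliqueSlots_succ_le (d n : ℕ) :
    tensorRankD (graphTensor F (cliqueSlots (d + 1)) (n ^ d)) ≤
      tensorRankD (graphTensor F (cliqueSlots d) n) ^ (d + 2) := by
  classical
  set R := tensorRankD (graphTensor F (cliqueSlots d) n) with hR
  obtain ⟨w, hw⟩ := exists_sum_rankOneTensor_eq_of_tensorRankD_le (le_refl R)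
  have key : graphTensor F (cliqueSlots (d + 1)) (n ^ d) =
      ∑ r : Fin (d + 2) → Fin R, rankOneTensor (cliqueCoverLeg fun a => w (r a)) := by
    rw [← cliqueCover_graphTensor, ← hw, cliqueCover_sum]
    simp_rw [cliqueCover_rankOneTensor]
  have hcard : Fintype.card (Fin (d + 2) → Fin R) = R ^ (d + 2) := by
    rw [Fintype.card_fun, Fintype.card_fin, Fintype.card_fin]
  let e : (Fin (d + 2) → Fin R) ≃ Fin (R ^ (d + 2)) := Fintype.equivFinOfCardEq hcard
  refine tensorRankD_le_of_eq_sum (fun t => cliqueCoverLeg fun a => w (e.symm t a)) ?_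
  rw [key]
  exact Fintype.sum_equiv e.symm _ _ (fun _ => rfl)

/-- The same bound at any level `N ≤ n^d` (level monotonicity). [cite: ChristandlVranaZuiddam2016, Prop. 1.1.26 (proof)] -/
theorem tensorRankD_cliqueSlots_succ_le_of_le {d n N : ℕ} (hN : N ≤ n ^ d) :
    tensorRankD (graphTensor F (cliqueSlots (d + 1)) N) ≤ tensorRankD (graphTensor F (cliqueSlots d) n) ^ (d + 2) :=
  (tensorRankD_graphTensor_mono (cliqueSlots (d + 1)) (cliqueSlots_covering (d + 1)) hN).trans
    (tensorRankD_cliqueSlots_succ_le F d n)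

end RankBound


/-! ## §4 Exponents: `ω(T(K_{d+2})) ≤ (d+2)/d · ω(T(K_{d+1}))`, `τ(T(K_{d+2})) ≤ τ(T(K_{d+1}))`, the discharge -/

section Exponent

variable (F : Type*) [Field F]

/-- **An admissible exponent `β` of `T(K_{d+1})` gives the admissible exponent `(d+2)/d · β` of `T(K_{d+2})`**
(`d ≥ 1`): at the level `m(N) = ⌈N^{1/d}⌉` one has `N ≤ m(N)^d`, so
`R(T_N(K_{d+2})) ≤ R(T_{m(N)}(K_{d+1}))^{d+2} = O(m(N)^{β(d+2)}) = O(N^{β(d+2)/d})` (`m(N) ≤ 2 N^{1/d}`).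
[cite: ChristandlVranaZuiddam2016, Prop. 1.1.26 (proof)] -/
theorem mem_graphExponents_cliqueSlots_succ {d : ℕ} (hd : 1 ≤ d) {β : ℝ}
    (hβ : β ∈ graphExponents F (cliqueSlots d)) :
    ((d : ℝ) + 2) / d * β ∈ graphExponents F (cliqueSlots (d + 1)) := by
  have hβ0 : 0 ≤ β := nonneg_of_mem_graphExponents (cliqueSlots_covering d) hβ
  have hd0 : (0 : ℝ) < d := by exact_mod_cast hd
  rw [mem_graphExponents_iff] at hβ ⊢
  -- the level `m N = ⌈N^{1/d}⌉`
  set m : ℕ → ℕ := fun N => ⌈((N : ℝ) ^ (d : ℝ)⁻¹)⌉₊ with hm_def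
  have hNm : ∀ N : ℕ, N ≤ m N ^ d := fun N => by
    have h0 : (0 : ℝ) ≤ (N : ℝ) ^ (d : ℝ)⁻¹ := Real.rpow_nonneg (Nat.cast_nonneg _) _
    have h1 : ((N : ℝ) ^ (d : ℝ)⁻¹) ^ d ≤ ((m N : ℕ) : ℝ) ^ d := pow_le_pow_left₀ h0 (Nat.le_ceil _) d
    rw [Real.rpow_inv_natCast_pow (Nat.cast_nonneg _) (by omega)] at h1
    exact_mod_cast h1
  have hm : Tendsto m atTop atTop :=
    tendsto_nat_ceil_atTop.comp ((tendsto_rpow_atTop (inv_pos.2 hd0)).comp tendsto_natCast_atTop_atTop)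
  -- `R(T_N(K_{d+2})) ≤ R(T_{m N}(K_{d+1}))^{d+2} = O((m N)^{β (d+2)}) = O(N^{β (d+2)/d})`
  have h1 : (fun N : ℕ => (tensorRankD (graphTensor F (cliqueSlots (d + 1)) N) : ℝ)) =O[atTop]
      fun N : ℕ => ((tensorRankD (graphTensor F (cliqueSlots d) (m N)) : ℝ) ^ (d + 2)) := by
    refine IsBigO.of_bound 1 (Eventually.of_forall fun N => ?_)
    rw [one_mul, Real.norm_of_nonneg (Nat.cast_nonneg _), Real.norm_of_nonneg (pow_nonneg (Nat.cast_nonneg _) _)]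
    exact_mod_cast tensorRankD_cliqueSlots_succ_le_of_le F (hNm N)
  have h2 : (fun N : ℕ => ((tensorRankD (graphTensor F (cliqueSlots d) (m N)) : ℝ) ^ (d + 2))) =O[atTop]
      fun N : ℕ => (((m N : ℕ) : ℝ) ^ β) ^ (d + 2) := (hβ.comp_tendsto hm).pow (d + 2)
  have h3 : (fun N : ℕ => (((m N : ℕ) : ℝ) ^ β) ^ (d + 2)) =O[atTop]
      fun N : ℕ => (N : ℝ) ^ (((d : ℝ) + 2) / d * β) := by
    refine IsBigO.of_bound ((2 : ℝ) ^ (β * ((d : ℝ) + 2))) ?_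
    filter_upwards [eventually_ge_atTop 1] with N hN
    have hN' : (1 : ℝ) ≤ N := by exact_mod_cast hN
    have hx0 : (0 : ℝ) ≤ (N : ℝ) ^ (d : ℝ)⁻¹ := Real.rpow_nonneg (Nat.cast_nonneg _) _
    have hx1 : (1 : ℝ) ≤ (N : ℝ) ^ (d : ℝ)⁻¹ := Real.one_le_rpow hN' (inv_nonneg.2 hd0.le)
    have hm0 : (0 : ℝ) ≤ ((m N : ℕ) : ℝ) := Nat.cast_nonneg _
    have hmN : ((m N : ℕ) : ℝ) ≤ 2 * (N : ℝ) ^ (d : ℝ)⁻¹ := by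
      have h' : ((m N : ℕ) : ℝ) < (N : ℝ) ^ (d : ℝ)⁻¹ + 1 := Nat.ceil_lt_add_one hx0
      linarith
    rw [Real.norm_of_nonneg (pow_nonneg (Real.rpow_nonneg hm0 _) _),
      Real.norm_of_nonneg (Real.rpow_nonneg (Nat.cast_nonneg _) _), ← Real.rpow_natCast,
      ← Real.rpow_mul hm0]
    push_cast
    calc ((m N : ℕ) : ℝ) ^ (β * ((d : ℝ) + 2))
        ≤ (2 * (N : ℝ) ^ (d : ℝ)⁻¹) ^ (β * ((d : ℝ) + 2)) :=
          Real.rpow_le_rpow hm0 hmN (mul_nonneg hβ0 (by linarith))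
      _ = (2 : ℝ) ^ (β * ((d : ℝ) + 2)) * (N : ℝ) ^ (((d : ℝ) + 2) / d * β) := by
          rw [Real.mul_rpow (by norm_num) hx0, ← Real.rpow_mul (Nat.cast_nonneg _)]
          congr 2
          field_simp
  exact h1.trans (h2.trans h3)

/-- **`ω(T(K_{d+2})) ≤ (d+2)/d · ω(T(K_{d+1}))`** for `d ≥ 1` — the printed
`ω(T(K_k)) ≤ binom(ℓ,2) binom(k,ℓ) binom(k-2,ℓ-2)^{-1} τ_ℓ` at `ℓ = k − 1 = d + 1`.
[cite: ChristandlVranaZuiddam2016, Prop. 1.1.26 (proof)] -/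
theorem graphOmega_cliqueSlots_succ_le {d : ℕ} (hd : 1 ≤ d) :
    graphOmega F (cliqueSlots (d + 1)) ≤ ((d : ℝ) + 2) / d * graphOmega F (cliqueSlots d) := by
  have hd0 : (0 : ℝ) < d := by exact_mod_cast hd
  have hc : (0 : ℝ) < ((d : ℝ) + 2) / d := div_pos (by linarith) hd0
  refine le_of_forall_gt_imp_ge_of_dense fun γ hγ => ?_
  have hβ : graphOmega F (cliqueSlots d) < γ / (((d : ℝ) + 2) / d) := by
    rw [lt_div_iff₀ hc, mul_comm]
    exact hγ
  have h := graphOmega_le_of_mem (cliqueSlots_covering (d + 1))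
    (mem_graphExponents_cliqueSlots_succ F hd (mem_graphExponents_of_lt (cliqueSlots_covering d) hβ))
  rwa [mul_div_cancel₀ _ hc.ne'] at h

/-- `d · binom(d+2, 2) = (d+2) · binom(d+1, 2)` (= `binom(ℓ,2) binom(k,ℓ) = binom(k,2) binom(k-2,ℓ-2)` at
`ℓ = k − 1`). [cite: ChristandlVranaZuiddam2016, Prop. 1.1.26 (proof)] -/
theorem cast_choose_two_cliqueCover (d : ℕ) :
    ((d : ℝ) + 2) * (((d + 1).choose 2 : ℕ) : ℝ) = (d : ℝ) * (((d + 1 + 1).choose 2 : ℕ) : ℝ) := by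
  have h1 : (d + 1 + 1) * (d + 1) = (d + 1 + 1).choose 2 * 2 := by
    have h := Nat.add_one_mul_choose_eq (d + 1) 1
    simpa [Nat.choose_one_right] using h
  have h2 : (d + 1) * d = (d + 1).choose 2 * 2 := by
    have h := Nat.add_one_mul_choose_eq d 1
    simpa [Nat.choose_one_right] using h
  have h1' : ((d : ℝ) + 1 + 1) * ((d : ℝ) + 1) = (((d + 1 + 1).choose 2 : ℕ) : ℝ) * 2 := by exact_mod_cast h1
  have h2' : ((d : ℝ) + 1) * (d : ℝ) = (((d + 1).choose 2 : ℕ) : ℝ) * 2 := by exact_mod_cast h2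
  nlinarith [h1', h2']

/-- **`τ(T(K_{d+2})) ≤ τ(T(K_{d+1}))`** for `d ≥ 1` (CVZ19 Prop. 1.1.26 for consecutive cliques, every field).
[cite: ChristandlVranaZuiddam2016, Prop. 1.1.26] -/
theorem graphTau_cliqueSlots_succ_le {d : ℕ} (hd : 1 ≤ d) :
    graphTau F (cliqueSlots (d + 1)) ≤ graphTau F (cliqueSlots d) := by
  unfold graphTau
  rw [card_cliqueEdge, card_cliqueEdge]
  have hd0 : (0 : ℝ) < d := by exact_mod_cast hd
  have hC1 : (0 : ℝ) < (((d + 1).choose 2 : ℕ) : ℝ) := by exact_mod_cast Nat.choose_pos (by omega)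
  have hC2 : (0 : ℝ) < (((d + 1 + 1).choose 2 : ℕ) : ℝ) := by exact_mod_cast Nat.choose_pos (by omega)
  rw [div_le_div_iff₀ hC2 hC1]
  have h := graphOmega_cliqueSlots_succ_le F hd
  calc graphOmega F (cliqueSlots (d + 1)) * (((d + 1).choose 2 : ℕ) : ℝ)
      ≤ ((d : ℝ) + 2) / d * graphOmega F (cliqueSlots d) * (((d + 1).choose 2 : ℕ) : ℝ) :=
        mul_le_mul_of_nonneg_right h hC1.le
    _ = graphOmega F (cliqueSlots d) * ((((d : ℝ) + 2) * (((d + 1).choose 2 : ℕ) : ℝ)) / d) := by ring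
    _ = graphOmega F (cliqueSlots d) * (((d + 1 + 1).choose 2 : ℕ) : ℝ) := by
        rw [cast_choose_two_cliqueCover, mul_div_assoc, mul_div_cancel₀ _ hd0.ne']

/-- **`τ(T(K_{d₁+1})) ≤ τ(T(K_{d₂+1}))` for `1 ≤ d₂ ≤ d₁`** (CVZ19 Prop. 1.1.26, every field), by induction from the
consecutive case. [cite: ChristandlVranaZuiddam2016, Prop. 1.1.26] -/
theorem graphTau_cliqueSlots_antitone {d₁ d₂ : ℕ} (hd₂ : 1 ≤ d₂) (h : d₂ ≤ d₁) :
    graphTau F (cliqueSlots d₁) ≤ graphTau F (cliqueSlots d₂) := by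
  induction d₁, h using Nat.le_induction with
  | base => exact le_rfl
  | succ d hd ih => exact (graphTau_cliqueSlots_succ_le F (hd₂.trans hd)).trans ih

/-- **Discharge of the named fact `cvz19_prop_1_1_26`** (`GraphTensor.lean`): "Let `k ≥ ℓ ≥ 2` be integers. Then
`τ(T(K_k)) ≤ τ(T(K_ℓ))`" (`K_k = cliqueSlots d₁`, `K_ℓ = cliqueSlots d₂`, `k = d₁ + 1 ≥ ℓ = d₂ + 1 ≥ 2`).
[cite: ChristandlVranaZuiddam2016, Prop. 1.1.26] -/
theorem cvz19_prop_1_1_26_holds : cvz19_prop_1_1_26 :=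
  fun _ _ hd₂ h => graphTau_cliqueSlots_antitone ℂ hd₂ h

end Exponent

end Literature.Computability.AlgebraicComplexity

end
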